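import Literature.IUT.HodgeTheaters.Cor53iLiftsAllAtArithmeticGlobalModel
import HarnessLib

/-!
# [IUTchI] Cor 5.3 (i), surjectivity half, at the ISOMORPHS `†ℱ^⊛` of the genuine arithmetic model: `HasLift`
# transports along equivalences of the structure functors, so every `†ℱ^⊛ → Base(†ℱ^⊛)` lifts modulo Neukirch–Uchida

S. Mochizuki, *Inter-universal Teichmüller theory I*, kurims manuscript (May 2020), §5 Corollary 5.3 (i) p. 144
l. 2–11 («the natural map `Isom(¹ℱ^⊛, ²ℱ^⊛) → Isom(Base(¹ℱ^⊛), Base(²ℱ^⊛))` … is bijective»); Example 5.1 (iii)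
pp. 125–126 («any category `†ℱ^⊛` equivalent to `ℱ^⊛(†𝒟^⊚)`», with its identification `Base(†ℱ^⊛) ⥲ †𝒟^⊛`)
([IUTchI] Cor 5.3 (i) p.144) [claim: Mochizuki2012, status: disputed] (D-0012 claim key; PROOFS ONLY; nothing of the
series is asserted; no side is taken on [IUTchIII] Cor. 3.12); [IUTchI] §0 p. 33 («an isomorphism class of
equivalences … an isomorphism between the two categories»).

PROOF-ONLY companion (cell abc-iut, L5 hub node `IUTchI:Cor5.3(i)`, seat abc-iut-w4-d109 gen 9, row C53ILIFT — the
record-level twin of `Cor53iLiftsAllAtArithmeticGlobalModel`, p525660):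

* `CatIsomorphism.hasLift_of_equivalences` — pure category theory: abc-iut-w4-d047's binder `HasLift p p` («over every
  self-equivalence of the base lies one of the total category») TRANSPORTS along equivalences `e : C' ≌ C`, `i : D' ≌ D`
  compatible with the structure functors (`p' ⋙ i ≅ e ⋙ p`): `HasLift p p → HasLift p' p'` (conjugate the base
  equivalence by `i`, lift, conjugate back by `e`);
* `GlobalFrobenioid.liftsAll_toBase_arith_of_neukirchUchida` — hence for EVERY isomorph record
  `𝓕 : GlobalFrobenioid (GlobalDivisorData.arith F) Dcirc toBase0` of abc-iut-L5-t1 (`equiv : †ℱ^⊛ ≌ ℱ^⊛(†𝒟^⊚)`,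
  `identify : Base(†ℱ^⊛) ≌ †𝒟^⊛`, `toBase_compat`), the binder `hlift` of abc-iut-L5-t4's
  `Cor53.record_descendBijective_of_kernel_trivial_of_lifts` (p495797) HOLDS modulo `NeukirchUchida F` BY NAME;
* one-calls `Cor53.record_descend_surjective_of_neukirchUchida` (the §0 natural map `Aut(†ℱ^⊛) → Aut(Base †ℱ^⊛)`
  is surjective — LAW ∅ · FACT {NeukirchUchida F}) and `Cor53.record_descendBijective_of_kernel_trivial_of_neukirchUchida`
  («bijective» modulo LAW {hker} · FACT {NeukirchUchida F}).

0 `def`, no instance, no notation, no new `Prop`; a named fact held as hypothesis is bookkeeping, not a proof of it;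
nothing here asserts abc proved or refuted.
-/

noncomputable section

namespace Literature.IUT.HodgeTheaters

open CategoryTheory Literature.AlgebraicGeometry.Frobenioids Literature.NumberTheory.GaloisRepresentations

universe v₁ v₂ v₃ v₄ u₁ u₂ u₃ u₄

/-! ### `HasLift` transports along compatible equivalences -/

namespace CatIsomorphism

variable {C : Type u₁} [Category.{v₁} C] {D : Type u₂} [Category.{v₂} D]
  {C' : Type u₃} [Category.{v₃} C'] {D' : Type u₄} [Category.{v₄} D']

/-- **`HasLift` is invariant under equivalence of the data `(C → D)`** (§0 p. 33: isomorphisms of categories are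
isomorphism classes of equivalences): if `p' ⋙ i ≅ e ⋙ p` for equivalences `e : C' ⥲ C`, `i : D' ⥲ D`, then every
self-equivalence of `D'` has one of `C'` over it as soon as the same holds for `p : C → D` — lift
`i⁻¹ ∘ Θ' ∘ i` to `Ψ` and take `e ∘ Ψ ∘ e⁻¹`. ([IUTchI] §0 p.33) [claim: Mochizuki2012, status: disputed] -/
theorem hasLift_of_equivalences (p : C ⥤ D) (p' : C' ⥤ D') (e : C' ≌ C) (i : D' ≌ D)
    (compat : p' ⋙ i.functor ≅ e.functor ⋙ p) (h : HasLift p p) : HasLift p' p' := by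
  intro Θ'
  obtain ⟨Ψ, ⟨hΨ⟩⟩ := h (i.symm.trans (Θ'.trans i))
  refine ⟨e.trans (Ψ.trans e.symm), ⟨?_⟩⟩
  -- `p' ≅ e ⋙ p ⋙ i⁻¹`
  have c0 : p' ≅ e.functor ⋙ p ⋙ i.inverse :=
    p'.rightUnitor.symm ≪≫ Functor.isoWhiskerLeft p' i.unitIso ≪≫ (Functor.associator _ _ _).symm ≪≫
      Functor.isoWhiskerRight compat i.inverse ≪≫ Functor.associator _ _ _
  -- `e⁻¹ ⋙ p' ≅ p ⋙ i⁻¹`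
  have c1 : e.inverse ⋙ p' ≅ p ⋙ i.inverse :=
    Functor.isoWhiskerLeft e.inverse c0 ≪≫ e.invFunIdAssoc (p ⋙ i.inverse)
  -- `Ψ ⋙ p ⋙ i⁻¹ ≅ p ⋙ i⁻¹ ⋙ Θ'` (the lifted square, with `i ⋙ i⁻¹ ≅ 𝟭` cancelled)
  have c2 : Ψ.functor ⋙ p ⋙ i.inverse ≅ p ⋙ i.inverse ⋙ Θ'.functor :=
    (Functor.associator _ _ _).symm ≪≫ Functor.isoWhiskerRight hΨ i.inverse ≪≫ Functor.associator _ _ _ ≪≫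
      Functor.isoWhiskerLeft p (Functor.associator _ _ _ ≪≫ Functor.isoWhiskerLeft i.inverse
        (Functor.associator _ _ _ ≪≫ Functor.isoWhiskerLeft Θ'.functor i.unitIso.symm ≪≫ Θ'.functor.rightUnitor))
  -- assemble: `(e ⋙ Ψ ⋙ e⁻¹) ⋙ p' ≅ e ⋙ Ψ ⋙ p ⋙ i⁻¹ ≅ e ⋙ p ⋙ i⁻¹ ⋙ Θ' ≅ p' ⋙ Θ'`
  change (e.functor ⋙ Ψ.functor ⋙ e.inverse) ⋙ p' ≅ p' ⋙ Θ'.functor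
  exact Functor.associator _ _ _ ≪≫ Functor.isoWhiskerLeft e.functor (Functor.associator _ _ _ ≪≫
      Functor.isoWhiskerLeft Ψ.functor c1 ≪≫ c2) ≪≫
    (Functor.associator _ _ _).symm ≪≫ (Functor.associator _ _ _).symm ≪≫
    Functor.isoWhiskerRight ((Functor.associator _ _ _) ≪≫ c0.symm) Θ'.functor

end CatIsomorphism

/-! ### The record-level `hlift` at the isomorphs `†ℱ^⊛` of the genuine arithmetic model -/

namespace GlobalFrobenioid

variable {F : Type} [Field F] [NumberField F] {Dcirc : Type 1} [Category.{0} Dcirc]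
  {toBase0 : Dcirc ⥤ BaseCat (absGalGrp F)} (𝓕 : GlobalFrobenioid (GlobalDivisorData.arith F) Dcirc toBase0)

/-- **[IUTchI] Cor 5.3 (i), SURJECTIVITY half, for every isomorph `†ℱ^⊛` of `ℱ^⊛(†𝒟^⊚)`** (Ex 5.1 (iii) «any category
equivalent to `ℱ^⊛(†𝒟^⊚)`»): under every self-equivalence of `Base(†ℱ^⊛)` lies a self-equivalence of `†ℱ^⊛` — the
model-level lift of abc-iut-w4-d109 (`GlobalDivisorData.liftsAll_modelBase_arith_of_neukirchUchida`) transported along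
the record's `equiv`, `identify`, `toBase_compat`.  CONDITIONAL on `NeukirchUchida F` BY NAME; this is the binder
`hlift` of `Cor53.record_descendBijective_of_kernel_trivial_of_lifts` (p495797), verbatim.
([IUTchI] Cor 5.3 (i) p.144) [claim: Mochizuki2012, status: disputed] -/
theorem liftsAll_toBase_arith_of_neukirchUchida (hNU : NeukirchUchida F) :
    ∀ Θ : 𝓕.Base ≌ 𝓕.Base, ∃ Ψ : 𝓕.cat ≌ 𝓕.cat, Nonempty (CatIsomorphism.LiesUnder 𝓕.toBase 𝓕.toBase Ψ Θ) :=
  CatIsomorphism.hasLift_of_equivalences (GlobalDivisorData.arith F).modelBase 𝓕.toBase 𝓕.equiv 𝓕.identify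
    𝓕.toBase_compat (GlobalDivisorData.liftsAll_modelBase_arith_of_neukirchUchida F hNU)

end GlobalFrobenioid

namespace Cor53

variable {F : Type} [Field F] [NumberField F] {Dcirc : Type 1} [Category.{0} Dcirc]
  {toBase0 : Dcirc ⥤ BaseCat (absGalGrp F)} (𝓕 : GlobalFrobenioid (GlobalDivisorData.arith F) Dcirc toBase0)

/-- **The §0 natural map `Aut(†ℱ^⊛) → Aut(Base †ℱ^⊛)` is SURJECTIVE for every isomorph of the genuine arithmetic model**
(binders `he`/`hu` discharged by abc-iut-w4-d109 gen 8 `hasUnder_toBase_arith` / `underUnique_toBase_arith`; the lift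
by gen 9): LAW ∅ · FACT {`NeukirchUchida F`}. ([IUTchI] Cor 5.3 (i) p.144) [claim: Mochizuki2012, status: disputed] -/
theorem record_descend_surjective_of_neukirchUchida (hNU : NeukirchUchida F) :
    Function.Surjective (CatIsomorphism.descend (GlobalFrobenioid.hasUnder_toBase_arith 𝓕 𝓕)
      (GlobalFrobenioid.underUnique_toBase_arith 𝓕 𝓕)) :=
  CatIsomorphism.descend_surjective_of_lifts _ _ (𝓕.liftsAll_toBase_arith_of_neukirchUchida hNU)

/-- **[IUTchI] Cor 5.3 (i) AS PRINTED («bijective») for every isomorph `†ℱ^⊛` of the genuine arithmetic model**, census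
after this file: LAW {hker — kernel triviality along `†ℱ^⊛ → Base(†ℱ^⊛)`, = Ex 5.1 (v)} · FACT {`NeukirchUchida F`}.
([IUTchI] Cor 5.3 (i) p.144) [claim: Mochizuki2012, status: disputed] -/
theorem record_descendBijective_of_kernel_trivial_of_neukirchUchida
    (hker : ∀ Ψ : 𝓕.cat ≌ 𝓕.cat,
      Nonempty (CatIsomorphism.LiesUnder 𝓕.toBase 𝓕.toBase Ψ (CategoryTheory.Equivalence.refl (C := 𝓕.Base))) →
      Nonempty (Ψ.functor ≅ 𝟭 𝓕.cat))
    (hNU : NeukirchUchida F) :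
    CatIsomorphism.DescendBijective 𝓕.toBase 𝓕.toBase (GlobalFrobenioid.hasUnder_toBase_arith 𝓕 𝓕)
      (GlobalFrobenioid.underUnique_toBase_arith 𝓕 𝓕) :=
  record_descendBijective_of_kernel_trivial_of_lifts 𝓕 hker (𝓕.liftsAll_toBase_arith_of_neukirchUchida hNU)

end Cor53

end Literature.IUT.HodgeTheaters

end
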